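import Summits.QuantumFields.BalabanUV.Beta.D1BFx.GluonLegBlockMass
import Summits.QuantumFields.BalabanUV.Beta.D1BFx.RankOneBubbleJets
import Summits.QuantumFields.BalabanUV.Beta.D1BFx.ProjectorColumnSharp

/-!
# `BalabanUV.Beta.D1BFx.NeedleProjLetters` — road «BF-x» for binder row D1, slot (K), END row `hGrp gN`, «GN-PP LETTERS»: THE TWO SCALAR LETTERS OF THE
# PROJECTOR-JET WORDS — the point value `|(Ga ∇P(·,q))(x,α)| ≤ kC·n⁻³·e^{−δ₁·dist(blk x, blk q)}` and the pairing `|⟨Ga ∇P(·,q), ∇P(p,·)⟩| ≤ kP·n⁻⁴`,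
# one `kC, kP ≥ 0`, `δ₁ > 0` for every `n ≥ 1`, modulo [B5, Prop. 1.2] ∧ [B5, (1.126)–(1.127)] BY NAME (an3-g57 §3′ (4) R1⊗R1: «`|Ga g| ≤ k n⁻³` (d0 suffices),
# `⟨g,Ga g′⟩ ≤ m_g·S_{Ga g′} = (4cPPsK/n)·k n⁻³ = k n⁻⁴`»)

HONEST DEPENDENCY (cell records, verbatim): «continuum YM on T⁴ ⇐ BetaPertH ∧ nine spine estimates (0/9 proved); BetaPertH ⇐ (D1) ∧ (D4) ∧
CAP+tail; G-an2-4 gates asym, D1 and NE2/3/4.»  HONEST FRAMING (cell contract, verbatim): «discharging `BetaPertH` makes Bałaban's UV stability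
UNCONDITIONAL — a real constructive-QFT result; it is NOT the continuum limit and NOT the Clay problem.»  THIS MODULE DISCHARGES NOTHING of the
wall: [folklore] lattice bookkeeping BY NAME over the owner's (L1)-MASS `GluonLegBlockMass.exists_sum_B_sum_abs_Ga_le` (block-row mass of `Ga`, `O(n²)`,
modulo `h12`∕`h126`), leaf-05-g41's projector letters `ProjectorSupNorm.abs_Pgt_diff_le_sup` (`cPPs·n⁻⁵·e^{−δ_PP·d}`) and `ProjectorColumnSharp.tsum_abs_Pgt_diff_col_le_sup`
(M4′: `cPPs∕n·K₄`), the block decomposition `NeedleRowLetters.tsum_eq_tsum_blocks` + `RProjector.abs_tsum_le_latticeConst`, and the owner's «GN-𝔅» objects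
`RankOneBubble.applyK`∕`applyKT`∕`pairing`, `RankOneBubbleJets.colGrad`∕`rowGrad`.  No `def`, no `def … : Prop`, nothing cited, 0 sorry; the printed statements
are HYPOTHESES by name.  Root-level binders hW ∕ hR-sockets ∕ hSX-socket ∕ D1Tel ∕ D1Rep — 0 discharged; (K) NOT closed; NOT D1, NOT `BetaPertH`, NOT
continuum, NOT Clay.

ABSOLUTE RULE (cell charter, verbatim): «No internally-minted statement may enter as a cited fact. Every hypothesis is either kernel-proved in
this package or a verbatim quotation of a PUBLISHED theorem with page reference. The manuscript(s) under audit are NOT citable for their own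
disputed steps — they are the thing under adjudication; programme-internal (2001/route/tribunal) claims are never citable.»

WHY (owner MINE «GN-L1-MASS» ∕ «GN-PP LETTERS» ∕ «GN-33∕PP», journal 2026-08-21T10:26Z; an3-g57 `N36-SPLIT.v1.md` §3′ (4) R1⊗R1).  By
`RankOneBubbleJets.bubble_dJetSw_dJetSw` the `projPiece ⊗ projPiece` word of T₃ is `(Ga c′)(u,κ)·(Ga c)(u′,κ′) − Ga(u,u′)·⟨Ga c, r′⟩ − ⟨r, Ga c′⟩·Ga(u′,u) +
(r Ga)(u′,κ′)·(r′ Ga)(u,κ)` with `c = ∇_col P(·,u⁺)`, `r = ∇_row P(u⁺,·)`; this file bounds the two scalar shapes that occur — the point value of `Ga` on a projector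
column gradient (kC) and the pairing of such a point-value function with a projector row gradient (kP) — with their n-powers `n⁻³`, `n⁻⁴` explicit.

CONTENT (`a > 0`; `n ≥ 1`).
* §1 [folklore] `applyKT_rowGrad_eq` — by the symmetries of `Pgt` and `Ga`: `applyKT (rowGrad (Pgt n a) p) (Ga n a) = applyK (Ga n a) (colGrad (Pgt n a) p)`.
* §2 [folklore] **`exists_applyK_colGrad_le`** (kC): `∃ kC δ₁, 0 < δ₁ ∧ 0 ≤ kC ∧ ∀ n [NeZero n] q x α, |applyK (Ga n a) (colGrad (Pgt n a) q) x α| ≤ kC∕n³·e^{−δ₁·dist(blk x, blk q)}`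
  (block by block: (L1)-MASS `C₁n²e^{−δ₁d(x̄,w′)}` × `cPPs n⁻⁵ e^{−δ_PP d(w′,q̄)}`, coarse triangle, `abs_tsum_le_latticeConst`); `exists_applyKT_rowGrad_le` (the twin by §1).
* §3 [folklore] **`exists_pairing_colGrad_rowGrad_le`** (kP): `∃ kP ≥ 0, ∀ n [NeZero n] q p, |pairing (applyK (Ga n a) (colGrad (Pgt n a) q)) (rowGrad (Pgt n a) p)| ≤ kP∕n⁴`
  (kC∕n³ × M4′ `cPPs∕n·K₄` × 4 directions; `tsum_of_norm_bounded`), and the transposed placement `exists_pairing_rowGrad_colGrad_le`.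
NOT HERE (honest): the `projPiece ⊗ projPiece` row itself («GN-33∕PP», next file); any other piece.
Unit `b2b-balaban-beta-d1-p2` (gen 10), road «BF-x» OWNER; `LEAVES-BFx.md` row (N) «GN-PP LETTERS».
-/

namespace Summit.QuantumFields.BalabanUV.Beta.D1BFx.NeedleProjLetters

open Finset Real
open scoped BigOperators
open Literature.MathematicalPhysics.QuantumFieldTheory.Balaban1983to89
open Literature.MathematicalPhysics.QuantumFieldTheory.Balaban1983to89.Beta
open B12Sec2to5 (l1 l1_nonneg)
open B4Sect5Proof (latticeConst latticeConst_nonneg)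
open B6QGQLower276 (X e blk B mem_B)
open ExpKernelCalculus (Site MKer Decays summable_exp_shift)
open DyadicShell (Pt supNorm)
open AffineAveraging (unitVec)
open VectorTailsLoc (fam kfam)
open Summit.QuantumFields.BalabanUV.Beta.TameKernelCalculus (Spr)
open Summit.QuantumFields.BalabanUV.Beta.D1BFx.RProjector (Pgt Pgt_symm abs_tsum_le_latticeConst deltaPP deltaPP_pos)
open Summit.QuantumFields.BalabanUV.Beta.D1BFx.ProjectorSupNorm (cPPs cPPs_nonneg abs_Pgt_diff_le_sup)
open Summit.QuantumFields.BalabanUV.Beta.D1BFx.ProjectorColumnSharp (summable_abs_Pgt_diff_col tsum_abs_Pgt_diff_col_le_sup)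
open Summit.QuantumFields.BalabanUV.Beta.D1BFx.NeedleRowLetters (tsum_eq_tsum_blocks)
open Summit.QuantumFields.BalabanUV.Beta.D1BFx.GluonLeg (Ga Ga_apply Ga_symm)
open Summit.QuantumFields.BalabanUV.Beta.D1BFx.GluonLegTails (spr_Ga_of_prop12)
open Summit.QuantumFields.BalabanUV.Beta.D1BFx.FrozenLegTails (nOf MOf hn1)
open Summit.QuantumFields.BalabanUV.Beta.D1BFx.GluonLegBlockMass (exists_sum_B_sum_abs_Ga_le)
open Summit.QuantumFields.BalabanUV.Beta.D1BFx.RankOneBubble (applyK applyKT pairing applyK_apply applyKT_apply pairing_def pairing_comm)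
open Summit.QuantumFields.BalabanUV.Beta.D1BFx.RankOneBubbleJets (colGrad rowGrad)

noncomputable section

variable (a : ℝ) (ha : 0 < a)

/-! ## §1 The right action on a projector row gradient is the left action on the projector column gradient -/

/-- [folklore] the road's unit vector is the block calculus' `e` (both `Pi.single · 1`). -/
theorem unitVec_eq_e' (β : Fin 4) : (unitVec β : Pt) = e β := rfl

/-- [folklore] **SYMMETRY**: `(∇_row P(p,·)) Ga = Ga (∇_col P(·,p))` as bond functions — from `Pgt_symm` and `Ga_symm`. -/
theorem applyKT_rowGrad_eq (ha : 0 < a) (n : ℕ) [NeZero n] (p : Pt) :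
    applyKT (rowGrad (Pgt n a) p) (Ga n a) = applyK (Ga n a) (colGrad (Pgt n a) p) := by
  funext z β
  rw [applyKT_apply, applyK_apply]
  refine tsum_congr fun y => Finset.sum_congr rfl fun α _ => ?_
  simp only [rowGrad, colGrad]
  rw [Pgt_symm n ha p (y + unitVec α), Pgt_symm n ha p y, Ga_symm n a NeZero.one_le ha y z α β]
  ring

/-! ## §2 (kC) The point value of `Ga` on a projector column gradient -/

/-- [folklore] the coarse exponent bookkeeping: `δ₁d₁ + δ₂d₂ ≥ (min δ₁ δ₂∕2)·d + (δ₁∕2)·d₁` whenever `d ≤ d₁ + d₂`, all nonnegative. -/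
theorem exp_blocks_le {δ₁ δ₂ d d₁ d₂ : ℝ} (hδ₁ : 0 ≤ δ₁) (hδ₂ : 0 ≤ δ₂) (hd₁ : 0 ≤ d₁) (hd₂ : 0 ≤ d₂) (htri : d ≤ d₁ + d₂) :
    Real.exp (-(δ₁ * d₁)) * Real.exp (-(δ₂ * d₂)) ≤ Real.exp (-(min δ₁ δ₂ / 2 * d)) * Real.exp (-(δ₁ / 2 * d₁)) := by
  rw [← Real.exp_add, ← Real.exp_add, Real.exp_le_exp]
  have hm1 : min δ₁ δ₂ ≤ δ₁ := min_le_left _ _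
  have hm2 : min δ₁ δ₂ ≤ δ₂ := min_le_right _ _
  have hm0 : 0 ≤ min δ₁ δ₂ := le_min hδ₁ hδ₂
  nlinarith [mul_le_mul_of_nonneg_left htri hm0, mul_nonneg hm0 hd₁, mul_nonneg hm0 hd₂, mul_nonneg hδ₁ hd₁, mul_nonneg hδ₂ hd₂,
    mul_le_mul_of_nonneg_right hm1 hd₁, mul_le_mul_of_nonneg_right hm2 hd₂]

/-- [folklore] **(kC) THE POINT VALUE OF `Ga` ON A PROJECTOR COLUMN GRADIENT IS `O(n⁻³)` WITH BLOCK DECAY**, modulo [B5, Prop. 1.2] ∧ [B5, (1.126)–(1.127)]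
BY NAME: one `kC ≥ 0`, `δ₁ > 0` with `|applyK (Ga n a) (colGrad (Pgt n a) q) x α| ≤ kC∕n³·e^{−δ₁·dist(blk (n−1) x, blk (n−1) q)}` for all `n ≥ 1`, `q`, `x`, `α`. -/
theorem exists_applyK_colGrad_le (h12 : B5.Prop12Printed (fam nOf hn1 MOf a ha)) (h126 : B5.Kernel126_127Printed (kfam nOf MOf)) :
    ∃ kC δ₁ : ℝ, 0 < δ₁ ∧ 0 ≤ kC ∧ ∀ (n : ℕ) [NeZero n] (q x : Pt) (α : Fin 4),
      |applyK (Ga n a) (colGrad (Pgt n a) q) x α| ≤ kC / (n : ℝ) ^ 3 * Real.exp (-(δ₁ * dist (blk (n - 1) x) (blk (n - 1) q))) := by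
  obtain ⟨C₁, δ₁, hδ₁, hC₁, hmass⟩ := exists_sum_B_sum_abs_Ga_le a ha h12 h126
  have hPP := deltaPP_pos 4 ha
  have hcP := cPPs_nonneg 4 ha
  refine ⟨C₁ * cPPs 4 a * latticeConst 4 (δ₁ / 2), min δ₁ (deltaPP 4 a) / 2, by positivity,
    by have := latticeConst_nonneg 4 (half_pos hδ₁).le; positivity, fun n _ q x α => ?_⟩
  have hn : (0 : ℝ) < n := by exact_mod_cast Nat.pos_of_ne_zero (NeZero.ne n)
  set m : ℕ := n - 1 with hm
  -- the summand of `applyK`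
  set F : Pt → ℝ := fun y => ∑ β : Fin 4, Ga n a x y α β * (Pgt n a (y + unitVec β) q () () - Pgt n a y q () ()) with hF
  have happ : applyK (Ga n a) (colGrad (Pgt n a) q) x α = ∑' y, F y := rfl
  -- the projector difference letter, block form
  have hP : ∀ (y : Pt) (β : Fin 4), |Pgt n a (y + unitVec β) q () () - Pgt n a y q () ()|
      ≤ cPPs 4 a / (n : ℝ) ^ 5 * Real.exp (-(deltaPP 4 a * dist (blk m y) (blk m q))) := fun y β => by
    rw [unitVec_eq_e']; exact abs_Pgt_diff_le_sup n ha y q β () ()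
  have hP' : ∀ (y : Pt) (β : Fin 4), |Pgt n a (y + unitVec β) q () () - Pgt n a y q () ()| ≤ cPPs 4 a / (n : ℝ) ^ 5 := fun y β =>
    (hP y β).trans (mul_le_of_le_one_right (by positivity) (by
      rw [Real.exp_le_one_iff]; have : 0 ≤ deltaPP 4 a * dist (blk m y) (blk m q) := by positivity
      linarith))
  -- pointwise bound of the summand
  have hFle : ∀ y, |F y| ≤ (∑ β : Fin 4, |Ga n a x y α β|) * (cPPs 4 a / (n : ℝ) ^ 5 * Real.exp (-(deltaPP 4 a * dist (blk m y) (blk m q)))) := by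
    intro y
    calc |F y| ≤ ∑ β : Fin 4, |Ga n a x y α β * (Pgt n a (y + unitVec β) q () () - Pgt n a y q () ())| := Finset.abs_sum_le_sum_abs _ _
      _ ≤ ∑ β : Fin 4, |Ga n a x y α β| * (cPPs 4 a / (n : ℝ) ^ 5 * Real.exp (-(deltaPP 4 a * dist (blk m y) (blk m q)))) :=
          Finset.sum_le_sum fun β _ => by rw [abs_mul]; exact mul_le_mul_of_nonneg_left (hP y β) (abs_nonneg _)
      _ = _ := by rw [Finset.sum_mul]
  -- summability of the summand (spread leg × bounded difference)
  have hsum : Summable F := by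
    obtain ⟨C, δ, hδ, hGa⟩ := spr_Ga_of_prop12 (a := a) (ha := ha) h12 h126 n
    have hC0 : 0 ≤ C := hGa.nonneg α
    refine Summable.of_norm_bounded (g := fun y => ∑ _β : Fin 4, C * Real.exp (-δ * l1 (x - y)) * (cPPs 4 a / (n : ℝ) ^ 5)) ?_ fun y => ?_
    · exact summable_sum fun β _ => ((summable_exp_shift hδ x).mul_left C).mul_right _
    · rw [Real.norm_eq_abs]
      refine (Finset.abs_sum_le_sum_abs _ _).trans (Finset.sum_le_sum fun β _ => ?_)
      rw [abs_mul]
      exact mul_le_mul (hGa x y α β) (hP' y β) (abs_nonneg _) (by positivity)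
  rw [happ, tsum_eq_tsum_blocks m hsum]
  -- the block bound
  have hdxq : 0 ≤ dist (blk m x) (blk m q) := dist_nonneg
  set M : ℝ := C₁ * cPPs 4 a / (n : ℝ) ^ 3 * Real.exp (-(min δ₁ (deltaPP 4 a) / 2 * dist (blk m x) (blk m q))) with hM
  have hM0 : 0 ≤ M := by positivity
  have hblk : ∀ w' : X 4, |∑ y ∈ B m w', F y| ≤ M * Real.exp (-(δ₁ / 2 * dist (blk m x) w')) := by
    intro w'
    have h1 : |∑ y ∈ B m w', F y| ≤ (∑ y ∈ B m w', ∑ β : Fin 4, |Ga n a x y α β|) *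
        (cPPs 4 a / (n : ℝ) ^ 5 * Real.exp (-(deltaPP 4 a * dist w' (blk m q)))) := by
      calc |∑ y ∈ B m w', F y| ≤ ∑ y ∈ B m w', |F y| := Finset.abs_sum_le_sum_abs _ _
        _ ≤ ∑ y ∈ B m w', (∑ β : Fin 4, |Ga n a x y α β|) * (cPPs 4 a / (n : ℝ) ^ 5 * Real.exp (-(deltaPP 4 a * dist w' (blk m q)))) :=
            Finset.sum_le_sum fun y hy => by have h := hFle y; rwa [mem_B.1 hy] at h
        _ = _ := by rw [Finset.sum_mul]
    have h2 := hmass n x w' α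
    have hd1 : 0 ≤ dist (blk m x) w' := dist_nonneg
    have hd2 : 0 ≤ dist w' (blk m q) := dist_nonneg
    have htri : dist (blk m x) (blk m q) ≤ dist (blk m x) w' + dist w' (blk m q) := dist_triangle _ _ _
    have hexp := exp_blocks_le hδ₁.le hPP.le hd1 hd2 htri
    calc |∑ y ∈ B m w', F y|
        ≤ (C₁ * (n : ℝ) ^ 2 * Real.exp (-(δ₁ * dist (blk m x) w'))) * (cPPs 4 a / (n : ℝ) ^ 5 * Real.exp (-(deltaPP 4 a * dist w' (blk m q)))) :=
          h1.trans (mul_le_mul_of_nonneg_right h2 (by positivity))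
      _ = C₁ * cPPs 4 a / (n : ℝ) ^ 3 * (Real.exp (-(δ₁ * dist (blk m x) w')) * Real.exp (-(deltaPP 4 a * dist w' (blk m q)))) := by
          field_simp
      _ ≤ C₁ * cPPs 4 a / (n : ℝ) ^ 3 *
            (Real.exp (-(min δ₁ (deltaPP 4 a) / 2 * dist (blk m x) (blk m q))) * Real.exp (-(δ₁ / 2 * dist (blk m x) w'))) :=
          mul_le_mul_of_nonneg_left hexp (by positivity)
      _ = M * Real.exp (-(δ₁ / 2 * dist (blk m x) w')) := by rw [hM]; ring
  refine (abs_tsum_le_latticeConst (half_pos hδ₁) hM0 (blk m x) hblk).trans (le_of_eq ?_)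
  rw [hM]; ring

/-- [folklore] **(kC), TRANSPOSED PLACEMENT**: the same bound for `applyKT (rowGrad (Pgt n a) p) (Ga n a) z β` (§1). -/
theorem exists_applyKT_rowGrad_le (h12 : B5.Prop12Printed (fam nOf hn1 MOf a ha)) (h126 : B5.Kernel126_127Printed (kfam nOf MOf)) :
    ∃ kC δ₁ : ℝ, 0 < δ₁ ∧ 0 ≤ kC ∧ ∀ (n : ℕ) [NeZero n] (p z : Pt) (β : Fin 4),
      |applyKT (rowGrad (Pgt n a) p) (Ga n a) z β| ≤ kC / (n : ℝ) ^ 3 * Real.exp (-(δ₁ * dist (blk (n - 1) z) (blk (n - 1) p))) := by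
  obtain ⟨kC, δ₁, hδ₁, hkC, h⟩ := exists_applyK_colGrad_le a ha h12 h126
  exact ⟨kC, δ₁, hδ₁, hkC, fun n _ p z β => by rw [applyKT_rowGrad_eq a ha n p]; exact h n p z β⟩

/-! ## §3 (kP) The pairing of `Ga ∇P(·,q)` with `∇P(p,·)` -/

/-- [folklore] **(kP) THE PAIRING `⟨Ga ∇_col P(·,q), ∇_row P(p,·)⟩` IS `O(n⁻⁴)`**, modulo [B5, Prop. 1.2] ∧ [B5, (1.126)–(1.127)] BY NAME: one `kP ≥ 0` with
`|pairing (applyK (Ga n a) (colGrad (Pgt n a) q)) (rowGrad (Pgt n a) p)| ≤ kP∕n⁴` for all `n ≥ 1`, `q`, `p` (kC∕n³ × M4′ `cPPs∕n·K₄(δ_PP)` × 4 directions). -/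
theorem exists_pairing_colGrad_rowGrad_le (h12 : B5.Prop12Printed (fam nOf hn1 MOf a ha)) (h126 : B5.Kernel126_127Printed (kfam nOf MOf)) :
    ∃ kP : ℝ, 0 ≤ kP ∧ ∀ (n : ℕ) [NeZero n] (q p : Pt),
      |pairing (applyK (Ga n a) (colGrad (Pgt n a) q)) (rowGrad (Pgt n a) p)| ≤ kP / (n : ℝ) ^ 4 := by
  obtain ⟨kC, δ₁, hδ₁, hkC, hKC⟩ := exists_applyK_colGrad_le a ha h12 h126
  have hPP := deltaPP_pos 4 ha
  have hcP := cPPs_nonneg 4 ha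
  have hK := latticeConst_nonneg 4 hPP.le
  refine ⟨kC * (4 * (cPPs 4 a * latticeConst 4 (deltaPP 4 a))), by positivity, fun n _ q p => ?_⟩
  have hn : (0 : ℝ) < n := by exact_mod_cast Nat.pos_of_ne_zero (NeZero.ne n)
  set φ := applyK (Ga n a) (colGrad (Pgt n a) q) with hφ
  -- the majorant
  set g : Pt → ℝ := fun x => ∑ β : Fin 4, kC / (n : ℝ) ^ 3 * |Pgt n a (x + e β) p () () - Pgt n a x p () ()| with hg
  have hgs : ∀ β : Fin 4, Summable fun x : Pt => kC / (n : ℝ) ^ 3 * |Pgt n a (x + e β) p () () - Pgt n a x p () ()| := fun β =>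
    (summable_abs_Pgt_diff_col n ha p β () ()).mul_left _
  have hgsum : Summable g := summable_sum fun β _ => hgs β
  have hle : ∀ x, ‖∑ β : Fin 4, φ x β * rowGrad (Pgt n a) p x β‖ ≤ g x := by
    intro x
    rw [Real.norm_eq_abs]
    refine (Finset.abs_sum_le_sum_abs _ _).trans (Finset.sum_le_sum fun β _ => ?_)
    rw [abs_mul]
    have h1 : |φ x β| ≤ kC / (n : ℝ) ^ 3 := (hKC n q x β).trans (mul_le_of_le_one_right (by positivity) (by
      rw [Real.exp_le_one_iff]; have : 0 ≤ δ₁ * dist (blk (n - 1) x) (blk (n - 1) q) := by positivity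
      linarith))
    have h2 : |rowGrad (Pgt n a) p x β| = |Pgt n a (x + e β) p () () - Pgt n a x p () ()| := by
      simp only [rowGrad]; rw [Pgt_symm n ha p (x + unitVec β), Pgt_symm n ha p x, unitVec_eq_e']
    rw [h2]
    exact mul_le_mul_of_nonneg_right h1 (abs_nonneg _)
  have h := tsum_of_norm_bounded hgsum.hasSum hle
  rw [Real.norm_eq_abs] at h
  rw [pairing_def]
  refine h.trans ?_
  rw [hg, Summable.tsum_finsetSum (fun β _ => hgs β)]
  calc ∑ β : Fin 4, ∑' x, kC / (n : ℝ) ^ 3 * |Pgt n a (x + e β) p () () - Pgt n a x p () ()|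
      = ∑ β : Fin 4, kC / (n : ℝ) ^ 3 * ∑' x, |Pgt n a (x + e β) p () () - Pgt n a x p () ()| := by simp_rw [tsum_mul_left]
    _ ≤ ∑ _β : Fin 4, kC / (n : ℝ) ^ 3 * (cPPs 4 a / (n : ℝ) * latticeConst 4 (deltaPP 4 a)) :=
        Finset.sum_le_sum fun β _ => mul_le_mul_of_nonneg_left (tsum_abs_Pgt_diff_col_le_sup n ha p β () ()) (by positivity)
    _ = kC * (4 * (cPPs 4 a * latticeConst 4 (deltaPP 4 a))) / (n : ℝ) ^ 4 := by
        rw [Finset.sum_const, Finset.card_univ, Fintype.card_fin, nsmul_eq_mul]; push_cast; field_simp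

/-- [folklore] **(kP), TRANSPOSED PLACEMENT**: `|pairing (rowGrad (Pgt n a) p) (applyK (Ga n a) (colGrad (Pgt n a) q))| ≤ kP∕n⁴` (`pairing_comm`). -/
theorem exists_pairing_rowGrad_colGrad_le (h12 : B5.Prop12Printed (fam nOf hn1 MOf a ha)) (h126 : B5.Kernel126_127Printed (kfam nOf MOf)) :
    ∃ kP : ℝ, 0 ≤ kP ∧ ∀ (n : ℕ) [NeZero n] (q p : Pt),
      |pairing (rowGrad (Pgt n a) p) (applyK (Ga n a) (colGrad (Pgt n a) q))| ≤ kP / (n : ℝ) ^ 4 := by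
  obtain ⟨kP, hkP, h⟩ := exists_pairing_colGrad_rowGrad_le a ha h12 h126
  exact ⟨kP, hkP, fun n _ q p => by rw [pairing_comm]; exact h n q p⟩

end

end Summit.QuantumFields.BalabanUV.Beta.D1BFx.NeedleProjLetters
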